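import Mathlib
import Summits.AtomisticToContinuum.FouriersLaw.Theses.EmbeddedDrudeMourre
import Summits.AtomisticToContinuum.FouriersLaw.Theorems.EmbeddedDrudeMourreDrudeDissolutionStubExcursionSecondDifferenceFloorLocalComoving
import HarnessLib

/-!
# The local gradient floor on the diagonal line away from the resonant sheet
# (stub B1b″ of line `kinetic-polymer-gas-on-the-time-axis`, step L3′ of the gradient floor (C4))
(crux `EmbeddedDrudeMourre.DrudeDissolution`, item stmt-AtomisticToContinuum-12593; `--supports` file, closes
nothing; lead c13)

WHAT. `gradient_floor_local_diag`: let `Ω = σ·A·S₁·S₂` (`σ = ±1`, `A ∈ C¹`, cell order, `S₁ p = sin((p.2.1−p.1)/2)`,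
`S₂ p = sin((p.2.1−p.2.2)/2)`). At a point `p₀` of the diagonal line `S₁ p₀ = S₂ p₀ = 0` (the intersection of the
two exchange planes, `k₁ ≡ k₂ ≡ k₃`) where the transversal coordinate does NOT vanish, `A p₀ ≠ 0`, there are
`r, c > 0` with `c·(A²S₁² + A²S₂² + S₁²S₂²) ≤ (∂₁Ω)² + (∂₂Ω)² + (∂₃Ω)²` on `dist p p₀ < r`.

HOW. `∇Ω = σ(A(S₂∇S₁ + S₁∇S₂) + S₁S₂∇A)`; the two plane normals `∇S₁ = (c₁/2)(−1,1,0)`, `∇S₂ = (c₂/2)(0,1,−1)`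
make the EXACT angle `|u·v| = |u||v|/2`, so `sumSq_lincomb_ge_of_angle` (`ρ = 1/2`) gives
`|S₂∇S₁ + S₁∇S₂|² ≥ (S₂²c₁² + S₁²c₂²)/4`; near `p₀`, `cᵢ² ≥ 1/2`, `A² ≥ A(p₀)²/2`, `|∇A|` is bounded and `S₁², S₂²`
are small, so the `S₁S₂∇A` term and the quartic part of `m²` are absorbed.
-/

noncomputable section

open Set Real Topology Metric
open Literature.MathematicalPhysics.KineticTheory
open Literature.MathematicalPhysics.KineticTheory.PhononBoltzmann

namespace Summit.AtomisticToContinuum.FouriersLaw.Theorems.DrudeDissolution.KineticPolymerGasOnTheTimeAxis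

/-- **The algebra of the diagonal floor.** With the partials of `Ω = σ·A·S₁·S₂` written out (`σ² = 1`),
`c₁², c₂² ≥ 1/2`, `A₀ ≤ A²`, `a₁² + a₂² + a₃² ≤ B`, and the smallness `64·B·S₁² ≤ A₀`:
`(A₀/64)·(S₁² + S₂²) ≤ Σⱼ(∂ⱼΩ)²`. [folklore] -/
theorem gradient_floor_local_diag_alg {σ A S₁ S₂ c₁ c₂ a₁ a₂ a₃ A₀ B : ℝ} (hσ : σ ^ 2 = 1)
    (hc₁ : 1 / 2 ≤ c₁ ^ 2) (hc₂ : 1 / 2 ≤ c₂ ^ 2) (hA : A₀ ≤ A ^ 2) (hA0 : 0 ≤ A₀)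
    (hB : a₁ ^ 2 + a₂ ^ 2 + a₃ ^ 2 ≤ B) (hsmall : 64 * B * S₁ ^ 2 ≤ A₀) :
    A₀ / 64 * (S₁ ^ 2 + S₂ ^ 2) ≤
      (σ * (S₁ * S₂ * a₁ + A * S₂ * (-(c₁ / 2)) + A * S₁ * 0)) ^ 2 +
        (σ * (S₁ * S₂ * a₂ + A * S₂ * (c₁ / 2) + A * S₁ * (c₂ / 2))) ^ 2 +
        (σ * (S₁ * S₂ * a₃ + A * S₂ * 0 + A * S₁ * (-(c₂ / 2)))) ^ 2 := by
  -- remove `σ`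
  have hrhs : (σ * (S₁ * S₂ * a₁ + A * S₂ * (-(c₁ / 2)) + A * S₁ * 0)) ^ 2 +
        (σ * (S₁ * S₂ * a₂ + A * S₂ * (c₁ / 2) + A * S₁ * (c₂ / 2))) ^ 2 +
        (σ * (S₁ * S₂ * a₃ + A * S₂ * 0 + A * S₁ * (-(c₂ / 2)))) ^ 2 =
      σ ^ 2 * ((S₁ * S₂ * a₁ + A * S₂ * (-(c₁ / 2)) + A * S₁ * 0) ^ 2 +
        (S₁ * S₂ * a₂ + A * S₂ * (c₁ / 2) + A * S₁ * (c₂ / 2)) ^ 2 +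
        (S₁ * S₂ * a₃ + A * S₂ * 0 + A * S₁ * (-(c₂ / 2))) ^ 2) := by ring
  rw [hrhs, hσ, one_mul]
  -- write each partial as `x + y` with `x` the main part and `y = S₁S₂aⱼ`, and use `(x+y)² ≥ x²/2 − y²`
  have e1 : S₁ * S₂ * a₁ + A * S₂ * (-(c₁ / 2)) + A * S₁ * 0 = A * (-(S₂ * c₁) / 2) + S₁ * S₂ * a₁ := by ring
  have e2 : S₁ * S₂ * a₂ + A * S₂ * (c₁ / 2) + A * S₁ * (c₂ / 2) = A * ((S₂ * c₁ + S₁ * c₂) / 2) + S₁ * S₂ * a₂ := by ring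
  have e3 : S₁ * S₂ * a₃ + A * S₂ * 0 + A * S₁ * (-(c₂ / 2)) = A * (-(S₁ * c₂) / 2) + S₁ * S₂ * a₃ := by ring
  rw [e1, e2, e3]
  have h1 := Literature.Analysis.Complex.half_sq_sub_sq_le_sq_add (A * (-(S₂ * c₁) / 2)) (S₁ * S₂ * a₁)
  have h2 := Literature.Analysis.Complex.half_sq_sub_sq_le_sq_add (A * ((S₂ * c₁ + S₁ * c₂) / 2)) (S₁ * S₂ * a₂)
  have h3 := Literature.Analysis.Complex.half_sq_sub_sq_le_sq_add (A * (-(S₁ * c₂) / 2)) (S₁ * S₂ * a₃)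
  -- the main part: `x₁² + x₂² + x₃² = A²((S₂c₁)² + (S₂c₁ + S₁c₂)² + (S₁c₂)²)/4 ≥ A²((S₂c₁)² + (S₁c₂)²)/8`
  -- (since `u² + (u+v)² + v² ≥ (u² + v²)/2`)
  have hmain : A ^ 2 * (S₂ * c₁) ^ 2 / 8 + A ^ 2 * (S₁ * c₂) ^ 2 / 8 ≤
      (A * (-(S₂ * c₁) / 2)) ^ 2 + (A * ((S₂ * c₁ + S₁ * c₂) / 2)) ^ 2 + (A * (-(S₁ * c₂) / 2)) ^ 2 := by
    have key : (A * (-(S₂ * c₁) / 2)) ^ 2 + (A * ((S₂ * c₁ + S₁ * c₂) / 2)) ^ 2 + (A * (-(S₁ * c₂) / 2)) ^ 2 -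
        (A ^ 2 * (S₂ * c₁) ^ 2 / 8 + A ^ 2 * (S₁ * c₂) ^ 2 / 8) =
        A ^ 2 * ((S₂ * c₁) ^ 2 + (S₁ * c₂) ^ 2) / 8 + A ^ 2 * (S₂ * c₁ + S₁ * c₂) ^ 2 / 4 := by ring
    have h0 : 0 ≤ A ^ 2 * ((S₂ * c₁) ^ 2 + (S₁ * c₂) ^ 2) / 8 + A ^ 2 * (S₂ * c₁ + S₁ * c₂) ^ 2 / 4 := by positivity
    linarith
  -- the error part
  have herr : (S₁ * S₂ * a₁) ^ 2 + (S₁ * S₂ * a₂) ^ 2 + (S₁ * S₂ * a₃) ^ 2 ≤ B * (S₁ ^ 2 * S₂ ^ 2) := by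
    have : (S₁ * S₂ * a₁) ^ 2 + (S₁ * S₂ * a₂) ^ 2 + (S₁ * S₂ * a₃) ^ 2 = (a₁ ^ 2 + a₂ ^ 2 + a₃ ^ 2) * (S₁ ^ 2 * S₂ ^ 2) := by
      ring
    rw [this]
    exact mul_le_mul_of_nonneg_right hB (by positivity)
  -- floors on the main part
  have hf1 : A₀ / 2 * S₂ ^ 2 ≤ A ^ 2 * (S₂ * c₁) ^ 2 := by
    have h : A₀ * (1 / 2) ≤ A ^ 2 * c₁ ^ 2 := mul_le_mul hA hc₁ (by norm_num) (sq_nonneg _)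
    calc A₀ / 2 * S₂ ^ 2 = A₀ * (1 / 2) * S₂ ^ 2 := by ring
      _ ≤ A ^ 2 * c₁ ^ 2 * S₂ ^ 2 := mul_le_mul_of_nonneg_right h (sq_nonneg _)
      _ = A ^ 2 * (S₂ * c₁) ^ 2 := by ring
  have hf2 : A₀ / 2 * S₁ ^ 2 ≤ A ^ 2 * (S₁ * c₂) ^ 2 := by
    have h : A₀ * (1 / 2) ≤ A ^ 2 * c₂ ^ 2 := mul_le_mul hA hc₂ (by norm_num) (sq_nonneg _)
    calc A₀ / 2 * S₁ ^ 2 = A₀ * (1 / 2) * S₁ ^ 2 := by ring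
      _ ≤ A ^ 2 * c₂ ^ 2 * S₁ ^ 2 := mul_le_mul_of_nonneg_right h (sq_nonneg _)
      _ = A ^ 2 * (S₁ * c₂) ^ 2 := by ring
  -- absorb the error: `B S₁² S₂² ≤ (A₀/64) S₂²`
  have habs : B * (S₁ ^ 2 * S₂ ^ 2) ≤ A₀ / 64 * S₂ ^ 2 := by
    have : B * S₁ ^ 2 ≤ A₀ / 64 := by linarith
    calc B * (S₁ ^ 2 * S₂ ^ 2) = (B * S₁ ^ 2) * S₂ ^ 2 := by ring
      _ ≤ A₀ / 64 * S₂ ^ 2 := mul_le_mul_of_nonneg_right this (sq_nonneg _)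
  have hx : 0 ≤ A₀ * S₁ ^ 2 := mul_nonneg hA0 (sq_nonneg _)
  linarith [h1, h2, h3, hmain, herr, hf1, hf2, habs, hx]

/-- **Registered sub-goal `gradient_floor_local_diag` (L3′ of the gradient floor): the local floor on the
diagonal line away from the resonant sheet.** Let `Ω q = σ·A q·sin((q.2.1−q.1)/2)·sin((q.2.1−q.2.2)/2)` with
`σ = ±1`, `A ∈ C¹`. If `sin((p₀.2.1−p₀.1)/2) = 0`, `sin((p₀.2.1−p₀.2.2)/2) = 0` and `A p₀ ≠ 0`, then there are
`r, c > 0` such that for `dist p p₀ < r`, with `S₁ = sin((p.2.1−p.1)/2)`, `S₂ = sin((p.2.1−p.2.2)/2)`: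
`c·((A p)²S₁² + (A p)²S₂² + S₁²S₂²) ≤ (fderiv Ω p (1,0,0))² + (fderiv Ω p (0,1,0))² + (fderiv Ω p (0,0,1))²`.
[folklore] -/
theorem gradient_floor_local_diag :
    ∀ (Ω A : ℝ × ℝ × ℝ → ℝ) (σ : ℝ) (p₀ : ℝ × ℝ × ℝ), (σ = 1 ∨ σ = -1) → ContDiff ℝ 1 A →
      (∀ q, Ω q = σ * A q * Real.sin ((q.2.1 - q.1) / 2) * Real.sin ((q.2.1 - q.2.2) / 2)) →
      Real.sin ((p₀.2.1 - p₀.1) / 2) = 0 → Real.sin ((p₀.2.1 - p₀.2.2) / 2) = 0 → A p₀ ≠ 0 →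
      ∃ r c : ℝ, 0 < r ∧ 0 < c ∧ ∀ p : ℝ × ℝ × ℝ, dist p p₀ < r →
        c * ((A p) ^ 2 * Real.sin ((p.2.1 - p.1) / 2) ^ 2 + (A p) ^ 2 * Real.sin ((p.2.1 - p.2.2) / 2) ^ 2 +
            Real.sin ((p.2.1 - p.1) / 2) ^ 2 * Real.sin ((p.2.1 - p.2.2) / 2) ^ 2) ≤
          (fderiv ℝ Ω p (1, 0, 0)) ^ 2 + (fderiv ℝ Ω p (0, 1, 0)) ^ 2 + (fderiv ℝ Ω p (0, 0, 1)) ^ 2 := by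
  intro Ω A σ p₀ hσ hA hΩ hS₁ hS₂ hA0
  have hσ2 : σ ^ 2 = 1 := by rcases hσ with h | h <;> rw [h] <;> norm_num
  have hAc : Continuous A := hA.continuous
  have hAd : ∀ p, DifferentiableAt ℝ A p := fun p => (hA.differentiable one_ne_zero) p
  have hfd : Continuous fun p => fderiv ℝ A p := hA.continuous_fderiv one_ne_zero
  have ha : ∀ e : ℝ × ℝ × ℝ, Continuous fun p => fderiv ℝ A p e := fun e =>
    (ContinuousLinearMap.apply ℝ ℝ e).continuous.comp hfd
  have cS₁ : Continuous fun p : ℝ × ℝ × ℝ => Real.sin ((p.2.1 - p.1) / 2) := by fun_prop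
  have cc₁ : Continuous fun p : ℝ × ℝ × ℝ => Real.cos ((p.2.1 - p.1) / 2) ^ 2 := by fun_prop
  have cc₂ : Continuous fun p : ℝ × ℝ × ℝ => Real.cos ((p.2.1 - p.2.2) / 2) ^ 2 := by fun_prop
  -- values at `p₀`
  have hc₁0 : Real.cos ((p₀.2.1 - p₀.1) / 2) ^ 2 = 1 := by
    have := Real.sin_sq_add_cos_sq ((p₀.2.1 - p₀.1) / 2); rw [hS₁] at this; linarith
  have hc₂0 : Real.cos ((p₀.2.1 - p₀.2.2) / 2) ^ 2 = 1 := by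
    have := Real.sin_sq_add_cos_sq ((p₀.2.1 - p₀.2.2) / 2); rw [hS₂] at this; linarith
  set A₀ : ℝ := (A p₀) ^ 2 / 2 with hA₀def
  have hA₀ : 0 < A₀ := by rw [hA₀def]; positivity
  set G : ℝ × ℝ × ℝ → ℝ := fun p => (fderiv ℝ A p (1, 0, 0)) ^ 2 + (fderiv ℝ A p (0, 1, 0)) ^ 2 +
    (fderiv ℝ A p (0, 0, 1)) ^ 2 with hG
  have cG : Continuous G := by rw [hG]; exact (((ha _).pow 2).add ((ha _).pow 2)).add ((ha _).pow 2)
  set B : ℝ := G p₀ + 1 with hB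
  have hG0 : 0 ≤ G p₀ := by rw [hG]; positivity
  have hBpos : 0 < B := by rw [hB]; linarith
  -- balls
  obtain ⟨r₁, hr₁, hb₁⟩ := exists_ball_gt_of_continuousAt cc₁.continuousAt (by rw [hc₁0]; norm_num : (1 / 2 : ℝ) < _)
  obtain ⟨r₂, hr₂, hb₂⟩ := exists_ball_gt_of_continuousAt cc₂.continuousAt (by rw [hc₂0]; norm_num : (1 / 2 : ℝ) < _)
  have hA₀lt : A₀ < (A p₀) ^ 2 := by
    have : 0 < A p₀ ^ 2 := by positivity
    rw [hA₀def]; linarith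
  obtain ⟨r₃, hr₃, hb₃⟩ := exists_ball_gt_of_continuousAt (hAc.pow 2).continuousAt hA₀lt
  obtain ⟨r₄, hr₄, hb₄⟩ := exists_ball_lt_of_continuousAt cG.continuousAt (lt_add_one (G p₀))
  have cS₁sq : Continuous fun p : ℝ × ℝ × ℝ => Real.sin ((p.2.1 - p.1) / 2) ^ 2 := cS₁.pow 2
  have h5lt : Real.sin ((p₀.2.1 - p₀.1) / 2) ^ 2 < A₀ / (64 * B) := by
    rw [hS₁]; simp only [ne_eq, OfNat.ofNat_ne_zero, not_false_eq_true, zero_pow]; positivity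
  obtain ⟨r₅, hr₅, hb₅⟩ := exists_ball_lt_of_continuousAt cS₁sq.continuousAt h5lt
  have h6lt : (A p₀) ^ 2 < 2 * (A p₀) ^ 2 + 1 := by linarith [sq_nonneg (A p₀)]
  obtain ⟨r₆, hr₆, hb₆⟩ := exists_ball_lt_of_continuousAt (hAc.pow 2).continuousAt h6lt
  set U : ℝ := 2 * (A p₀) ^ 2 + 1 with hU
  have hUpos : 0 < U := by rw [hU]; positivity
  refine ⟨min r₁ (min r₂ (min r₃ (min r₄ (min r₅ r₆)))), A₀ / 64 / (U + 1),
    lt_min hr₁ (lt_min hr₂ (lt_min hr₃ (lt_min hr₄ (lt_min hr₅ hr₆)))), by positivity, fun p hp => ?_⟩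
  have hp₁ : dist p p₀ < r₁ := lt_of_lt_of_le hp (min_le_left _ _)
  have hp₂ : dist p p₀ < r₂ := lt_of_lt_of_le hp ((min_le_right _ _).trans (min_le_left _ _))
  have hp₃ : dist p p₀ < r₃ := lt_of_lt_of_le hp ((min_le_right _ _).trans ((min_le_right _ _).trans (min_le_left _ _)))
  have hp₄ : dist p p₀ < r₄ :=
    lt_of_lt_of_le hp ((min_le_right _ _).trans ((min_le_right _ _).trans ((min_le_right _ _).trans (min_le_left _ _))))
  have hp₅ : dist p p₀ < r₅ :=
    lt_of_lt_of_le hp ((min_le_right _ _).trans ((min_le_right _ _).trans ((min_le_right _ _).trans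
      ((min_le_right _ _).trans (min_le_left _ _)))))
  have hp₆ : dist p p₀ < r₆ :=
    lt_of_lt_of_le hp ((min_le_right _ _).trans ((min_le_right _ _).trans ((min_le_right _ _).trans
      ((min_le_right _ _).trans (min_le_right _ _)))))
  -- the partials at `p`
  obtain ⟨e11, e12, e13⟩ := fderiv_S1_apply p
  obtain ⟨e21, e22, e23⟩ := fderiv_S2_apply p
  have d1 := fderiv_factorised_apply Ω A σ p (1, 0, 0) (hAd p) hΩ
  have d2 := fderiv_factorised_apply Ω A σ p (0, 1, 0) (hAd p) hΩ
  have d3 := fderiv_factorised_apply Ω A σ p (0, 0, 1) (hAd p) hΩ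
  rw [e11, e21] at d1
  rw [e12, e22] at d2
  rw [e13, e23] at d3
  rw [d1, d2, d3]
  have hsmall : 64 * B * Real.sin ((p.2.1 - p.1) / 2) ^ 2 ≤ A₀ := by
    have h := (hb₅ p hp₅).le
    rw [le_div_iff₀ (by positivity)] at h
    linarith
  have halg := gradient_floor_local_diag_alg (σ := σ) (A := A p) (S₁ := Real.sin ((p.2.1 - p.1) / 2))
    (S₂ := Real.sin ((p.2.1 - p.2.2) / 2)) (c₁ := Real.cos ((p.2.1 - p.1) / 2)) (c₂ := Real.cos ((p.2.1 - p.2.2) / 2))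
    (a₁ := fderiv ℝ A p (1, 0, 0)) (a₂ := fderiv ℝ A p (0, 1, 0)) (a₃ := fderiv ℝ A p (0, 0, 1))
    (A₀ := A₀) (B := B) hσ2 (hb₁ p hp₁).le (hb₂ p hp₂).le (by have := hb₃ p hp₃; simpa using this.le) hA₀.le
    (by have := (hb₄ p hp₄).le; simp only [hG, hB] at this ⊢; exact this) hsmall
  refine le_trans ?_ halg
  -- `m² ≤ (U + 1)(S₁² + S₂²)` near `p₀`
  have hAU : (A p) ^ 2 ≤ U := by have := hb₆ p hp₆; simpa using this.le
  have hS1le : Real.sin ((p.2.1 - p.1) / 2) ^ 2 ≤ 1 := by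
    rw [sq_le_one_iff_abs_le_one]; exact Real.abs_sin_le_one _
  have hm : (A p) ^ 2 * Real.sin ((p.2.1 - p.1) / 2) ^ 2 + (A p) ^ 2 * Real.sin ((p.2.1 - p.2.2) / 2) ^ 2 +
      Real.sin ((p.2.1 - p.1) / 2) ^ 2 * Real.sin ((p.2.1 - p.2.2) / 2) ^ 2 ≤
      (U + 1) * (Real.sin ((p.2.1 - p.1) / 2) ^ 2 + Real.sin ((p.2.1 - p.2.2) / 2) ^ 2) := by
    have t1 : (A p) ^ 2 * Real.sin ((p.2.1 - p.1) / 2) ^ 2 ≤ U * Real.sin ((p.2.1 - p.1) / 2) ^ 2 :=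
      mul_le_mul_of_nonneg_right hAU (sq_nonneg _)
    have t2 : (A p) ^ 2 * Real.sin ((p.2.1 - p.2.2) / 2) ^ 2 ≤ U * Real.sin ((p.2.1 - p.2.2) / 2) ^ 2 :=
      mul_le_mul_of_nonneg_right hAU (sq_nonneg _)
    have t3 : Real.sin ((p.2.1 - p.1) / 2) ^ 2 * Real.sin ((p.2.1 - p.2.2) / 2) ^ 2 ≤
        1 * Real.sin ((p.2.1 - p.2.2) / 2) ^ 2 := mul_le_mul_of_nonneg_right hS1le (sq_nonneg _)
    linarith [t1, t2, t3, sq_nonneg (Real.sin ((p.2.1 - p.1) / 2))]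
  have hU1 : 0 < U + 1 := by linarith
  calc A₀ / 64 / (U + 1) * ((A p) ^ 2 * Real.sin ((p.2.1 - p.1) / 2) ^ 2 +
        (A p) ^ 2 * Real.sin ((p.2.1 - p.2.2) / 2) ^ 2 +
        Real.sin ((p.2.1 - p.1) / 2) ^ 2 * Real.sin ((p.2.1 - p.2.2) / 2) ^ 2)
      ≤ A₀ / 64 / (U + 1) * ((U + 1) * (Real.sin ((p.2.1 - p.1) / 2) ^ 2 + Real.sin ((p.2.1 - p.2.2) / 2) ^ 2)) :=
        mul_le_mul_of_nonneg_left hm (by positivity)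
    _ = A₀ / 64 * (Real.sin ((p.2.1 - p.1) / 2) ^ 2 + Real.sin ((p.2.1 - p.2.2) / 2) ^ 2) := by
        rw [← mul_assoc, div_mul_cancel₀ _ hU1.ne']

end Summit.AtomisticToContinuum.FouriersLaw.Theorems.DrudeDissolution.KineticPolymerGasOnTheTimeAxis

end
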